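import Summits.ABC.IUTFork.Cor312EtaleLedger
import HarnessLib

/-!
# [IUTchIII] Cor. 3.12, proof chain — the identification-of-copies ledger: converse checks (proof-only)

Record-only, PROOF-ONLY supplement (abc-iut cell, D-0067 wave 4, seat abc-iut-w4-d021; RQ7 audit finding
W4D021-C2-F1 on `Cor312EtaleLedger.lean` p411270, abc-iut-c312-13 TEAM C row C-2) — TAKES NO SIDE on
[IUTchIII] Cor. 3.12. The ledger's headline `Cor312Proof.setLevel_only_at_xi_f` quantifies over the ledger
author's own assignment `Step.idents` and is tied to abc-iut-c312-2's per-node data (`Cor312Steps.lean`: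
`Step.cites` / `Step.concl` / `Step.uses`) in ONE direction only (`idents_justified`: assigned ⇒ eligible). This
file records, machine-checked against c312-2's data, the other direction for the set-level kind:

* `setLevel_drawn_only_at_xi_f` — the set-level marker observation `Obs.constitutesConstruction` (the (xi-f)
  sentence, kurims `paper:url-4b091feeb646` p. 184 l. 19–29) is DRAWN (`concl`) at exactly one node, (xi-f);
* `setLevel_invoked_exactly_at_xi_g` — it is INVOKED (`uses`) at exactly one node, (xi-g) ("two tautologically
  equivalent ways to compute the log-volume of the `q`-pilot object", p. 184 l. 30–34);
* `not_setLevel_marker_only_at_xi_f` — hence the marker-level converse of the headline FAILS: by the ledger's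
  own eligibility rule ("drawn or invoked") the kind `setLevelInclusion` is eligible at (xi-f) AND (xi-g);
* `setLevel_eligible_iff` — eligibility census: exactly the nodes (xi-f), (xi-g).

Reading for the roll-up: per c312-2's data the set-level identification is INTRODUCED at (xi-f) and CONSUMED at
(xi-g) — the node at which TEAM B's GAP row G-c312-11-1 (`QFrobComparison`) and Scholze–Stix §2.2 locate the
disputed comparison. All proofs are `decide` over c312-2's finite tables; bookkeeping only, [folklore].
Deliberately NOT here: any change to the ledger's assignments (one writer: abc-iut-c312-13); any judgement.
-/

namespace Summit.ABC

namespace IUTFork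

namespace Cor312Proof

open Locus Obs

/-- The set-level marker observation `constitutesConstruction` is DRAWN (a conclusion) at exactly one printed
node of the proof of Cor. 3.12: (xi-f) (c312-2's `Step.concl` data). [folklore] -/
theorem setLevel_drawn_only_at_xi_f :
    ∀ s ∈ Step.all, Obs.constitutesConstruction ∈ s.concl ↔ s = .xi_f := by
  decide

/-- The set-level marker observation is INVOKED (used as a premise) at exactly one printed node: (xi-g)
(c312-2's `Step.uses` data). [folklore] -/
theorem setLevel_invoked_exactly_at_xi_g :
    ∀ s ∈ Step.all, Obs.constitutesConstruction ∈ s.uses ↔ s = .xi_g := by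
  decide

/-- Hence the MARKER-LEVEL converse of the ledger's headline fails: it is not the case that the set-level marker
occurs (drawn or invoked) only at (xi-f) — (xi-g) invokes it. [folklore] -/
theorem not_setLevel_marker_only_at_xi_f :
    ¬ ∀ s ∈ Step.all,
      (Obs.constitutesConstruction ∈ s.concl ∨ Obs.constitutesConstruction ∈ s.uses) → s = .xi_f := by
  decide

/-- Eligibility census for the set-level kind under the ledger's own rule (`Ident.lociMarkers` /
`Ident.obsMarkers`: a kind may be assigned to a node iff a marker locus is cited or a marker observation is
drawn or invoked): `setLevelInclusion` is eligible at exactly (xi-f) and (xi-g). [folklore] -/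
theorem setLevel_eligible_iff :
    ∀ s ∈ Step.all,
      ((∃ c ∈ Ident.setLevelInclusion.lociMarkers, c ∈ s.cites) ∨
        ∃ o ∈ Ident.setLevelInclusion.obsMarkers, o ∈ s.concl ∨ o ∈ s.uses) ↔ (s = .xi_f ∨ s = .xi_g) := by
  decide

/-- The ledger assigns the set-level kind to (xi-f) but NOT to the eligible node (xi-g) (whose assignment is
`[qGluing, volInvariance]`): the headline "enters at exactly one node" is a property of the assignment, finer
than eligibility. [folklore] -/
theorem setLevel_assigned_xi_f_not_xi_g :
    Ident.setLevelInclusion ∈ Step.xi_f.idents ∧ Ident.setLevelInclusion ∉ Step.xi_g.idents ∧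
      Step.xi_g.idents = [Ident.qGluing, Ident.volInvariance] := by
  decide

end Cor312Proof

end IUTFork

end Summit.ABC
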